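import Literature.NumberTheory.EllipticCurves.RankinSelbergGenusTwist
import Literature.NumberTheory.EllipticCurves.LFunctionPrimeCoeff
import Mathlib.NumberTheory.LegendreSymbol.QuadraticReciprocity
import Mathlib.NumberTheory.Divisors
import HarnessLib

/-!
# Route `SchneiderFreeAdditiveX3` (K1 door), ANALYTIC side at `p = 3`: the `χ_{−3}`-twist is `θ` modulo `3`, and the `ω`-twist
# SWAPS the type of a weight-two Eisenstein series modulo `3` — the two `q`-expansion identities that put Keller–Yin's
# Eisenstein congruence for `(f̃, χ_ε)` at `p = 3` inside Castella–Grossi–Lee–Skinner 2022 §2.2 as printed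

Cell `bsd-schneider-ideate`, seat `bsd-schneider-door-c5` (prover, generation 26; assembly layer; `--supports` 19177).
PARTITION: board row B6 ∩ X3 ∩ sst-twist, `r = 1`, (G-ord, `e = 2`) half at `p = 3` (2 411 pairs; 686 NON-ANOMALOUS) of
`Rank1Residual.partition`; types-the-object-of nothing; supplies the ELEMENTARY ARITHMETIC behind the finding «at `p = 3` the door's
analytic inputs [AN] + [BR] are a composition of refereed print» (memo FINDING-door-c5-g26); closes none of B6's cells (BSD NOT advanced).
bears_on: K1-door (19177 r3 `GordTwoBranchIMC`).

WHY.  The one remaining ANALYTIC input of the door's lower half is Keller–Yin arXiv:2410.23241 §3.5 [p0020:L15–L21]: for the good-ordinary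
newform `f̃ = f_V` (level `N′`, `p ∤ N′`) and the genus branch `χ_ε` (`ε = χ_{p*}`, conductor `p`), "`𝓛_ε ≡ (𝓛_{G^{φε,ψε,N}})² (mod pΛ^ur)`,
`𝓛_G = 𝓔^ι·𝓛_{φε}`" — an Eisenstein congruence on the `ε`-BRANCH of the BDP measure of `f̃`, i.e. (Castella–Hsieh 2018 Def. 3.7, the
integrand twisted by `ε` on `ℤ_p^×`) for the `p`-adic modular form `F = f̃ ⊗ ε` of tame level `N′`, whose prime-to-`p` coefficients are
those of the door curve `W = V ⊗ ε`.  By Euler's criterion `ε(n) ≡ n^{(p−1)/2} (mod p)` (§1), so `F ≡ θ^{(p−1)/2} f̃ (mod p)` and PARTIAL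
Eisenstein descent (Kriz 2016 Thm. 34 (3) / Thm. 35: `θ^j f̃ ≡ θ^j G` for `j ≥ 1`, `G = E_2^{(ψ₁,ψ₂,N₊,N₋,N₀)}`, `{ψ₁, ψ₂ω} = V[p]^{ss}`)
gives `F♭ ≡ (G ⊗ ε)♭ (mod p)` with `G ⊗ ε = E_2^{ψ₁ε, ψ₂ε}` — at `p ≥ 5` an Eisenstein series with TWO `p`-RAMIFIED characters, outside
Kriz's Prop. 37 / CGLS's (eq:cor-37).  AT `p = 3`, `ε = ω` and (§2) `ω(d)·d ≡ d² ≡ 1 (mod 3)` turn the twisted divisor sum into the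
divisor sum of the SWAPPED type: `E_2^{(ψ₁,ψ₂,N₊,N₋,N₀)} ⊗ ω ≡ E_2^{(ψ₂,ψ₁,N₋,N₊,N₀)} (mod 3)` on coefficients prime to `3` (§2–§3).
So `F♭ ≡ (E_2^{φ′,φ′⁻¹})♭ (mod 3)` with `φ′ = ψ₂ = φ_V⁻¹` UNRAMIFIED at `3` — exactly CGLS's `G` for the pair `(φ′, ψ′) = (φ_V⁻¹, ωφ_V)`,
which IS `W[3]^{ss}` (§4: `a_ℓ(W) ≡ ℓ·a_ℓ(V) (mod 3)`, the trace form of `W[3] ≅ V[3] ⊗ ω`; census kit j319291 sscheck 0/6 794).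
From there CGLS 2022 Thm. 2.2.1's proof (measure congruence (eq:cor-meas), TeX L1111–1119; (eq:cor-37) = Kriz Prop. 37 for the
`p`-unramified `φ′`, L1092–1109), Thm. 2.2.2 (Hida's `μ = 0`, the functional equation (2.16)) and Thm. 1.2.2 (Rubin–Hida, for
`φ′|_{G_v̄} ∉ {𝟙, ω}` ⟺ `V` non-anomalous) apply VERBATIM: the memo's chain.  This file proves only the arithmetic (§1–§4); nothing
analytic is formalised or asserted.

* §1 `intCast_legendreSym_three` — `(n/3) ≡ n (mod 3)`; `intCast_legendreSym_eq_pow` — `(n/p) ≡ n^{(p−1)/2}` (Mathlib's Euler criterion,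
  recorded in the twist reading: `ε(n)·a_n ≡ n^{(p−1)/2}·a_n`).
* §2 `natCast_sq_eq_one_of_not_three_dvd`; **`three_mul_eisensteinCoeff_eq_swap`** — for `3 ∤ n` and ANY `ψ₁, ψ₂ : ℕ → ZMod 3`:
  `n · Σ_{d∣n} ψ₁(n/d) ψ₂(d) d = Σ_{d∣n} ψ₂(n/d) ψ₁(d) d` in `ZMod 3`; `legendreSym_three_mul_eisensteinCoeff_eq_swap` (the same with
  the twist character `(n/3)`).
* §3 the Kriz-type local coefficients at `ℓ ∣ N₊` (`ψ₁(ℓ)^k`) and `ℓ ∣ N₋` (`(ψ₂(ℓ)ℓ)^k`): `natCast_pow_mul_pow_eq_swap_plus/_minus` —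
  the `ω`-twist sends each to the other type's shape (`N₊ ↔ N₋`).
* §4 `intCast_frobeniusTrace_presentation_three` — for the door's presentation `W = C₂ • (D • W′)^{(−3)}` with newforms `f, f′`
  and a prime `ℓ ≠ 3` good for both: `a_ℓ(W) ≡ ℓ · a_ℓ(W′) (mod 3)` (tree: `cuspCoeff_eq_legendreSym_mul_of_presentation` + §1).

HONEST FRAMING: elementary theorems only (divisor sums over `ZMod 3`, Euler's criterion, one cast of the tree's twist relation); no
definition, no named fact, no `sorry`; no `p`-adic `L`-function, measure or main conjecture is mentioned in any statement; the
analytic composition they serve is a MEMO claim (FINDING-door-c5-g26 §2), to be audited like `pub/bsd-cited/sheets/D-AUDIT-r13-Q15`;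
«closes rung: none».  References: Kriz, ANT 10 (2016) Def. 31, Thm. 34 (3), Thm. 35, Prop. 37 [Kriz2016]; Castella–Grossi–Lee–Skinner,
Invent. Math. 227 (2022) Thms. 2.1.2, 2.2.1, 2.2.2 [CastellaGrossiLeeSkinner2022]; Castella–Hsieh, Math. Ann. 370 (2018) Def. 3.7 /
Prop. 3.8 [CastellaHsieh2018]; Keller–Yin arXiv:2410.23241 §3.5 [KellerYin2024b]; Miyake, *Modular Forms* Thm. 4.7.1 (the coefficients
`Σ_{d∣n} χ₁(n/d)χ₂(d)d^{k−1}` of `E_k^{χ₁,χ₂}`) [Miyake2006]; Ireland–Rosen Prop. 5.1.2 (Euler's criterion) [IrelandRosen1990].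
-/

set_option autoImplicit false
set_option linter.dupNamespace false -- the summit namespace `…BirchSwinnertonDyer.BirchSwinnertonDyer.Theorems` (Sub = Summit, D-0017) trips it

noncomputable section

open scoped Classical

open Finset WeierstrassCurve Literature.NumberTheory.EllipticCurves Literature.NumberTheory.EllipticCurves.ModularForms

namespace Summit.BirchSwinnertonDyer.BirchSwinnertonDyer.Theorems.SchneiderFreeAdditiveX3.TwistThreeSwap

/-! ### §1 Euler's criterion: the twist character is a power of `n` modulo `p`; at `p = 3` it is `n` itself -/

/-- **Euler's criterion (Mathlib), in the reading used here:** `(a/p) ≡ a^{(p−1)/2} (mod p)` — twisting a `q`-expansion by the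
quadratic character of conductor `p` is, modulo `p`, the operator `θ^{(p−1)/2}` on coefficients prime to `p`.
[cite: IrelandRosen1990, Prop. 5.1.2 (Euler's criterion)] -/
theorem intCast_legendreSym_eq_pow (p : ℕ) [Fact p.Prime] (a : ℤ) :
    ((legendreSym p a : ℤ) : ZMod p) = (a : ZMod p) ^ (p / 2) :=
  legendreSym.eq_pow p a

/-- **At `p = 3`: `(n/3) ≡ n (mod 3)`** — the `χ_{−3} = ω`-twist is `θ` modulo `3` (`(p−1)/2 = 1`). [cite: IrelandRosen1990, Prop. 5.1.2] -/
theorem intCast_legendreSym_three (a : ℤ) : ((legendreSym 3 a : ℤ) : ZMod 3) = (a : ZMod 3) := by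
  haveI : Fact (Nat.Prime 3) := ⟨Nat.prime_three⟩
  rw [legendreSym.eq_pow 3 a]
  norm_num

/-- The natural-number form: `((n/3) : ZMod 3) = n`. [cite: IrelandRosen1990, Prop. 5.1.2] -/
theorem intCast_legendreSym_three_natCast (n : ℕ) : ((legendreSym 3 n : ℤ) : ZMod 3) = (n : ZMod 3) := by
  rw [intCast_legendreSym_three, Int.cast_natCast]

/-- **The twist reading at a general odd `p`:** `(n/p) · a ≡ n^{(p−1)/2} · a (mod p)` for every coefficient `a` — i.e.
`(f ⊗ χ_{p*})♭ ≡ (θ^{(p−1)/2} f)♭ (mod p)` coefficientwise.  (At `p ≥ 5` this lands on an Eisenstein series with two `p`-RAMIFIED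
characters; only at `p = 3` does §2 swap it back to a `p`-unramified type.) [cite: IrelandRosen1990, Prop. 5.1.2] -/
theorem intCast_legendreSym_mul (p : ℕ) [Fact p.Prime] (n : ℕ) (a : ZMod p) :
    ((legendreSym p n : ℤ) : ZMod p) * a = (n : ZMod p) ^ (p / 2) * a := by
  rw [legendreSym.eq_pow p n, Int.cast_natCast]

/-! ### §2 The SWAP: `n · Σ_{d∣n} ψ₁(n/d)ψ₂(d)d = Σ_{d∣n} ψ₂(n/d)ψ₁(d)d` in `ZMod 3` for `3 ∤ n` -/

/-- `d² ≡ 1 (mod 3)` for `3 ∤ d` (Fermat). [folklore] -/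
theorem natCast_sq_eq_one_of_not_three_dvd {d : ℕ} (hd : ¬ 3 ∣ d) : ((d : ZMod 3) ^ 2 : ZMod 3) = 1 := by
  haveI : Fact (Nat.Prime 3) := ⟨Nat.prime_three⟩
  have hd0 : (d : ZMod 3) ≠ 0 := by rwa [Ne, ZMod.natCast_eq_zero_iff]
  simpa using ZMod.pow_card_sub_one_eq_one hd0

/-- `d · d ≡ 1 (mod 3)` for `3 ∤ d`. [folklore] -/
theorem natCast_mul_self_eq_one_of_not_three_dvd {d : ℕ} (hd : ¬ 3 ∣ d) : ((d : ZMod 3) * d : ZMod 3) = 1 := by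
  rw [← sq]; exact natCast_sq_eq_one_of_not_three_dvd hd

/-- **THE SWAP IDENTITY.**  For `3 ∤ n` and arbitrary functions `ψ₁, ψ₂ : ℕ → ZMod 3` (the two Dirichlet characters of a weight-two
Eisenstein series `E_2^{ψ₁,ψ₂} = Σ_n (Σ_{d∣n} ψ₁(n/d) ψ₂(d) d) qⁿ`, read modulo `3`):
`n · Σ_{d∣n} ψ₁(n/d) ψ₂(d) d = Σ_{d∣n} ψ₂(n/d) ψ₁(d) d` in `ZMod 3`.  Proof: reindex `d ↦ n/d` and use `n·(n/d) = d·(n/d)² ≡ d`.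
Reading: `θ E_2^{ψ₁,ψ₂} ≡ E_2^{ψ₁,ψ₂} ⊗ ω ≡ E_2^{ψ₂,ψ₁} (mod 3)` on coefficients prime to `3` — the `ω`-twist SWAPS the Eisenstein type
(and only at `p = 3`: the identity needs `d^{p−1}·… = d²`). [cite: Miyake2006, Thm. 4.7.1 (q-expansion of E_k^{χ₁,χ₂})] -/
theorem three_mul_eisensteinCoeff_eq_swap (ψ₁ ψ₂ : ℕ → ZMod 3) {n : ℕ} (hn : ¬ 3 ∣ n) :
    (n : ZMod 3) * ∑ d ∈ n.divisors, ψ₁ (n / d) * ψ₂ d * d = ∑ d ∈ n.divisors, ψ₂ (n / d) * ψ₁ d * d := by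
  -- reindex the left-hand sum by `d ↦ n / d`
  have hre : ∑ d ∈ n.divisors, ψ₁ (n / d) * ψ₂ d * d = ∑ d ∈ n.divisors, ψ₁ d * ψ₂ (n / d) * (n / d : ℕ) := by
    rw [← Nat.sum_div_divisors n (fun d ↦ ψ₁ d * ψ₂ (n / d) * (n / d : ℕ))]
    refine Finset.sum_congr rfl fun d hd ↦ ?_
    have hdn : d ∣ n := Nat.dvd_of_mem_divisors hd
    have hn0 : n ≠ 0 := (Nat.mem_divisors.mp hd).2
    rw [Nat.div_div_self hdn hn0]
  rw [hre, Finset.mul_sum]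
  refine Finset.sum_congr rfl fun d hd ↦ ?_
  have hdn : d ∣ n := Nat.dvd_of_mem_divisors hd
  have hnd : n = d * (n / d) := (Nat.mul_div_cancel' hdn).symm
  have h3 : ¬ 3 ∣ n / d := fun h ↦ hn (dvd_trans h (Nat.div_dvd_of_dvd hdn))
  have hsq := natCast_mul_self_eq_one_of_not_three_dvd h3
  have hcast : (n : ZMod 3) = (d : ZMod 3) * ((n / d : ℕ) : ZMod 3) := by rw [← Nat.cast_mul, ← hnd]
  calc (n : ZMod 3) * (ψ₁ d * ψ₂ (n / d) * ((n / d : ℕ) : ZMod 3))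
      = ψ₂ (n / d) * ψ₁ d * d * (((n / d : ℕ) : ZMod 3) * ((n / d : ℕ) : ZMod 3)) := by rw [hcast]; ring
    _ = ψ₂ (n / d) * ψ₁ d * d := by rw [hsq, mul_one]

/-- **The swap with the twist character:** `(n/3) · Σ_{d∣n} ψ₁(n/d)ψ₂(d)d = Σ_{d∣n} ψ₂(n/d)ψ₁(d)d` in `ZMod 3` for `3 ∤ n` — the
coefficientwise form of `E_2^{ψ₁,ψ₂} ⊗ χ_{−3} ≡ E_2^{ψ₂,ψ₁} (mod 3)` away from `3`. [cite: Miyake2006, Thm. 4.7.1] [cite: IrelandRosen1990, Prop. 5.1.2] -/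
theorem legendreSym_three_mul_eisensteinCoeff_eq_swap (ψ₁ ψ₂ : ℕ → ZMod 3) {n : ℕ} (hn : ¬ 3 ∣ n) :
    ((legendreSym 3 n : ℤ) : ZMod 3) * ∑ d ∈ n.divisors, ψ₁ (n / d) * ψ₂ d * d =
      ∑ d ∈ n.divisors, ψ₂ (n / d) * ψ₁ d * d := by
  rw [intCast_legendreSym_three_natCast, three_mul_eisensteinCoeff_eq_swap ψ₁ ψ₂ hn]

/-- The swap is an involution on the data: applying it to `(ψ₂, ψ₁)` returns the original sum (bookkeeping: `n·n ≡ 1`). [folklore] -/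
theorem three_mul_three_mul_eisensteinCoeff (ψ₁ ψ₂ : ℕ → ZMod 3) {n : ℕ} (hn : ¬ 3 ∣ n) :
    (n : ZMod 3) * ((n : ZMod 3) * ∑ d ∈ n.divisors, ψ₁ (n / d) * ψ₂ d * d) = ∑ d ∈ n.divisors, ψ₁ (n / d) * ψ₂ d * d := by
  rw [← mul_assoc, natCast_mul_self_eq_one_of_not_three_dvd hn, one_mul]

/-- **Only at `p = 3`.**  At `p = 5` the twisted divisor sum is NOT the swapped one: with `ψ₁ = ψ₂ = 1` and `n = 2`,
`2^{(5−1)/2}·σ(2) = 4·3 ≡ 2` while the swapped sum is `σ(2) = 3` (mod `5`).  (At `p ≥ 5`, `χ_{p*} = ω^{(p−1)/2}` and the twist of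
`E_2^{ψ₁,ψ₂}` has two `p`-ramified characters.) [folklore] -/
theorem pow_two_mul_eisensteinCoeff_ne_swap_five :
    (2 : ZMod 5) ^ (5 / 2) * (∑ d ∈ (2 : ℕ).divisors, (1 : ZMod 5) * 1 * d) ≠ ∑ d ∈ (2 : ℕ).divisors, (1 : ZMod 5) * 1 * d := by
  decide

/-! ### §3 The Kriz-type local coefficients at the primes of `N₊` and `N₋` swap as well -/

/-- **`ℓ ∣ N₊`:** the `N₊`-type coefficient `ψ₁(ℓ)^k` of `E_2^{(ψ₁,ψ₂,N₊,N₋,N₀)}` at `ℓ^k`, twisted by `ω(ℓ^k) ≡ ℓ^k`, is the `N₋`-type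
coefficient `(ψ₁(ℓ)·ℓ)^k` of the swapped series `E_2^{(ψ₂,ψ₁,N₋,N₊,N₀)}`. [cite: Kriz2016, Def. 31 and Thm. 34 (3) (the type (ψ₁,ψ₂,N₊,N₋,N₀))] -/
theorem natCast_pow_mul_pow_eq_swap_plus (ψ₁ : ℕ → ZMod 3) (ℓ k : ℕ) :
    ((ℓ ^ k : ℕ) : ZMod 3) * ψ₁ ℓ ^ k = (ψ₁ ℓ * ℓ) ^ k := by
  rw [Nat.cast_pow, mul_pow, mul_comm]

/-- **`ℓ ∣ N₋`, `3 ∤ ℓ`:** the `N₋`-type coefficient `(ψ₂(ℓ)·ℓ)^k`, twisted by `ω(ℓ^k) ≡ ℓ^k`, is the `N₊`-type coefficient `ψ₂(ℓ)^k`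
of the swapped series (`ℓ² ≡ 1`). [cite: Kriz2016, Def. 31 and Thm. 34 (3)] -/
theorem natCast_pow_mul_pow_eq_swap_minus (ψ₂ : ℕ → ZMod 3) {ℓ : ℕ} (hℓ : ¬ 3 ∣ ℓ) (k : ℕ) :
    ((ℓ ^ k : ℕ) : ZMod 3) * (ψ₂ ℓ * ℓ) ^ k = ψ₂ ℓ ^ k := by
  rw [Nat.cast_pow, ← mul_pow]
  congr 1
  calc (ℓ : ZMod 3) * (ψ₂ ℓ * ℓ) = ψ₂ ℓ * ((ℓ : ZMod 3) * ℓ) := by ring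
    _ = ψ₂ ℓ := by rw [natCast_mul_self_eq_one_of_not_three_dvd hℓ, mul_one]

/-- **`ℓ ∣ N₀`:** the coefficient `0` stays `0`. (Recorded for completeness of the type swap `(N₊,N₋,N₀) ↦ (N₋,N₊,N₀)`.) [cite: Kriz2016, Def. 31] -/
theorem natCast_pow_mul_zero_eq (ℓ k : ℕ) : ((ℓ ^ k : ℕ) : ZMod 3) * 0 = 0 := mul_zero _

/-! ### §4 The door's presentation: `a_ℓ(W) ≡ ℓ · a_ℓ(W′) (mod 3)` -/

/-- **Trace form of `W[3] ≅ W′[3] ⊗ ω` for the door's presentation.**  `W = C₂ • (D • W′)^{(−3)}` (the K1 door's (G-ord) presentation at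
`p = 3`: `(−1)^{3/2}·3 = −3`), `f, f′` the newforms of `W, W′`, `ℓ ≠ 3` a prime of good reduction for both: `a_ℓ(W) ≡ ℓ·a_ℓ(W′) (mod 3)`
— the tree's twist relation `a_ℓ(f) = (ℓ/3)·a_ℓ(f′)` (`cuspCoeff_eq_legendreSym_mul_of_presentation`) read through `a_ℓ = frobeniusTrace`
at good primes and §1.  (Census kit j319291: `a_ℓ(E) ≡ ℓ·a_ℓ(V) (mod 3)` for all good `ℓ ≤ 97`, 0 failures on 6 794 pairs.)
[cite: RubinSilverberg2002, §1 (a_p of a quadratic twist)] [cite: IrelandRosen1990, Prop. 5.1.2] -/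
theorem intCast_frobeniusTrace_presentation_three (W' : WeierstrassCurve ℚ) [W'.IsElliptic] [W'.IsGloballyMinimal]
    (D C₂ : VariableChange ℚ) [(C₂ • (D • W').quadraticTwist ((-1 : ℚ) ^ (3 / 2) * (3 : ℕ))).IsElliptic]
    [(C₂ • (D • W').quadraticTwist ((-1 : ℚ) ^ (3 / 2) * (3 : ℕ))).IsGloballyMinimal]
    {N N' : ℕ} [NeZero N] [NeZero N'] {f : CuspForm (CongruenceSubgroup.Gamma0 N) 2}
    {f' : CuspForm (CongruenceSubgroup.Gamma0 N') 2}
    (hf : IsNewformOf (C₂ • (D • W').quadraticTwist ((-1 : ℚ) ^ (3 / 2) * (3 : ℕ))) f) (hf' : IsNewformOf W' f')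
    {ℓ : ℕ} [Fact ℓ.Prime] (hℓ3 : ℓ ≠ 3)
    (hgood : (C₂ • (D • W').quadraticTwist ((-1 : ℚ) ^ (3 / 2) * (3 : ℕ))).HasGoodReductionAtPrime ℓ)
    (hgood' : W'.HasGoodReductionAtPrime ℓ) :
    (((C₂ • (D • W').quadraticTwist ((-1 : ℚ) ^ (3 / 2) * (3 : ℕ))).frobeniusTrace ℓ : ℤ) : ZMod 3) =
      (ℓ : ZMod 3) * ((W'.frobeniusTrace ℓ : ℤ) : ZMod 3) := by
  haveI : Fact (Nat.Prime 3) := ⟨Nat.prime_three⟩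
  have hℓ : ℓ.Prime := Fact.out
  -- the twist relation for the newforms, at the good prime `ℓ`
  have htw := cuspCoeff_eq_legendreSym_mul_of_presentation (p := 3) (by norm_num) W' D C₂ hf hf' hℓ hℓ3
  rw [hf.2 ℓ, hf'.2 ℓ, LFunction_apply_prime_eq_frobeniusTrace _ ℓ hgood, LFunction_apply_prime_eq_frobeniusTrace W' ℓ hgood']
    at htw
  -- read it in `ℤ`, then modulo `3`
  have hZ : (C₂ • (D • W').quadraticTwist ((-1 : ℚ) ^ (3 / 2) * (3 : ℕ))).frobeniusTrace ℓ =
      legendreSym 3 ℓ * W'.frobeniusTrace ℓ := by exact_mod_cast htw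
  rw [hZ, Int.cast_mul, intCast_legendreSym_three_natCast]

end Summit.BirchSwinnertonDyer.BirchSwinnertonDyer.Theorems.SchneiderFreeAdditiveX3.TwistThreeSwap

end
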